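import Mathlib.Analysis.InnerProductSpace.Calculus
import Literature.Analysis.FluidPDE.PressureRepresentation
import Literature.Analysis.FluidPDE.ClassicalSolutionCalculus
import HarnessLib

/-!
# Tao's pressure-normalisation lemma (Lemma 4.1 (i)): the discharge `tao_pressure_normalisation_holds`

Sibling of `NormalisedPressure.lean` (the named fact `NS.tao_pressure_normalisation`, Tao 2011 =
arXiv:1108.1165, Lemma 4.1 (i)) and of `NormalisedPressureProofs.lean` (the decomposition of the
printed proof into the inputs F0–F4). This file PROVES the fact (`tao_pressure_normalisation_holds`,
end of file) along Tao's printed argument. It is a separate module rather than an appendix to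
`NormalisedPressureProofs` because that file is upstream of `TaoEnergyLocalisationPressure` and
`NormalisedPressurePV`, whose pressure-kernel lemmas `PressureRepresentation` reuses.

## Inputs (all proved in the tree)

* F0, the pressure Poisson equation (Tao (8)): `PressurePoisson` (`tao2011_pressurePoisson_holds`
  below).
* F4, the weighted radial mean value property (Gilbarg–Trudinger Thm 2.1): `HarmonicMeanValue`
  (`harmonic_integral_mul_radial_holds` below), used through the **mean-value formula for the
  gradient** `∂ₐη(x₀) = ∫ ∂ₐχ_R(z) η(x₀ - z) dz` of `HarmonicProbe`.
* The singular-integral representation (`RadialCalculus`, `NewtonKernel`, `NewtonPotential`,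
  `PressureRepresentation`): for smooth finite-energy `v`, `normalisedPressure v = Q[v]` with
  `Q[v] ∈ C²`, `ΔQ[v] = -∂ᵢ∂ⱼ(vᵢvⱼ)` (this is F3, `laplacian_normalisedPressure_holds` below), and the
  duality/dilation bound `|∫ Q[v] ψ(R⁻¹(· - x₀))| ≤ M_ψ ∫|v|²` (Tao's "from the finite energy
  nature … this expression goes to zero as `R → ∞`"). F1 (existence of the principal values for
  `C¹` fields) is proved in `NormalisedPressurePV`; F1b/F2 are not needed on the smooth class met
  here.

## The assembly (Tao 2011, §4, proof of Lemma 4.1 (i), finite energy case)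

`h(t) = p(t) - Q[u(t)]` is harmonic at interior times (`harmonicOnNhd_pressure_sub_pressurePotential`:
(8) and `ΔQ = -∂ᵢ∂ⱼ(uᵢuⱼ)`). The **probe identity** (`fderiv_harmonicPart_eq`): with `χ_R` the
unit-mass radial bump at scale `R` and `φ = χ_R(· - x₀)`,
`∂ₐh(t,x₀) = ν∫⟪u,(Δφ)a⟫ + ∫⟪u,(u·∇φ)a⟫ - d/dt ∫⟪u,φa⟫ - ∫ ∂ₐχ_R(z) Q[u(t)](x₀ - z) dz`
(mean-value formula for `∇h`, then the momentum equation tested against `φ a`: Green's identity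
for the viscous term, the trilinear identity and `div u = 0` for the transport term). Each of the
four terms is `O((1 + E₀)/R)` uniformly in `t` (`exists_bound_probe_laplacian/transport/
boundary/potential`; Tao's `O(R^{-7/2})`, `O(R⁻⁴)`, `O(R^{-3/2})`, `R⁻⁴`-duality terms, estimated
crudely), so by the real-variable uniqueness lemma of `HarmonicProbe` (in place of Lebesgue
differentiation) `∇h(t) ≡ 0` for **every** interior `t` (`fderiv_harmonicPart_eq_zero`). Hence
`p(t,x) = Q[u(t)](x) + C(t)` with `C(t) = p(t,0) - Q[u(t)](0)` (clamped to `[0,T]` in `t`),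
which is measurable (parametric integrals of jointly measurable integrands) and bounded
(`Γ₀ ∈ L¹` against the jointly continuous source; `‖D²Γ∞‖_∞ E₀`). The viscosity enters only
through `ν · O(R⁻²)`, so every `ν > 0` is covered without Tao's rescaling to `ν = 1`.

## References

* T. Tao, *Localisation and compactness properties of the Navier–Stokes global regularity
  problem*, Anal. PDE 6 (2013) 25–107 = arXiv:1108.1165: (8); §4, Lemma 4.1 (i) and its proof
  (pp. 24–26 journal = pp. 14–15 arXiv).
* D. Gilbarg, N. S. Trudinger, *Elliptic partial differential equations of second order*
  (Springer, 2001 reprint): Thm 2.1, Lemma 4.2.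
-/

noncomputable section

open MeasureTheory Set Filter Metric Topology InnerProductSpace Function
open scoped ENNReal RealInnerProductSpace ContDiff Laplacian

namespace Literature.Analysis.FluidPDE

/-! ### Discharge of the inputs F0, F3, F4 -/

section DischargeInputs

variable {E : Type*} [NormedAddCommGroup E] [InnerProductSpace ℝ E] [FiniteDimensional ℝ E]

/-- **F0 discharged**: the pressure Poisson equation (Tao 2011, (8)) for the tree's classical
solutions, from `FluidPDE/PressurePoisson`. [cite: Tao2011, (8)] -/
theorem tao2011_pressurePoisson_holds : tao2011_pressurePoisson (E := E) :=
  fun _ _ _ _ _ h _ ht x => laplacian_pressure_eq_of_isClassicalNSSolutionOn h ht x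

variable [MeasurableSpace E] [BorelSpace E]

/-- **F4 discharged**: the weighted radial mean value property (Gilbarg–Trudinger Thm 2.1), from
`FluidPDE/HarmonicMeanValue` (only continuity of the weight is needed there). [cite: GilbargTrudinger2001, Thm 2.1] -/
theorem harmonic_integral_mul_radial_holds : harmonic_integral_mul_radial (E := E) :=
  fun _ _ hη hw hc hrad x₀ => integral_radial_mul_harmonic hη hw.continuous hc hrad x₀

end DischargeInputs

section DischargeR3

/-- Local notation for physical space `ℝ³ = EuclideanSpace ℝ (Fin 3)`. -/
local notation "ℝ³" => EuclideanSpace ℝ (Fin 3)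

/-- **F3 discharged**: for smooth finite-energy `v`, the normalised pressure is the pressure
potential `Q[v]` of `FluidPDE/PressureRepresentation`, which is `C²` with `ΔQ[v] = -∂ᵢ∂ⱼ(vᵢvⱼ)`
(Gilbarg–Trudinger Lemma 4.2). [cite: GilbargTrudinger2001, Lemma 4.2] -/
theorem laplacian_normalisedPressure_holds : laplacian_normalisedPressure := by
  intro v hv hE
  have hL2 : Integrable fun y => ‖v y‖ ^ 2 := integrable_sq_of_lintegral_enorm_sq_lt_top hv.continuous hE
  have h4 : ContDiff ℝ 4 v := contDiff_infty.1 hv 4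
  have h2 : ContDiff ℝ 2 v := contDiff_infty.1 hv 2
  rw [normalisedPressure_eq_pressurePotential' h2 hL2]
  exact ⟨contDiff_pressurePotential h4 hL2, fun x => laplacian_pressurePotential h4 hL2 x⟩

/-! ### The harmonic part of the pressure and the probe identity -/

variable {ν T : ℝ} {u : ℝ → ℝ³ → ℝ³} {p : ℝ → ℝ³ → ℝ}

/-- For a classical solution of the unforced system with a finite-energy slice, the harmonic part
`h(t) = p(t) - Q[u(t)]` of the pressure is harmonic on `ℝ³` at every interior time
(Tao 2011, §4: "`p = p₀ + h` with `h` harmonic", from (8) and `ΔQ = -∂ᵢ∂ⱼ(uᵢuⱼ)`). [cite: Tao2011, §4, proof of Lemma 4.1 (i)] -/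
theorem harmonicOnNhd_pressure_sub_pressurePotential
    (h : FluidPDE.IsClassicalNSSolutionOn (Icc 0 T) ν 0 u p) {t : ℝ} (ht : t ∈ Ioo 0 T)
    (hL2 : Integrable fun y => ‖u t y‖ ^ 2) :
    HarmonicOnNhd (fun x => p t x - pressurePotential (u t) x) univ := by
  have htI : t ∈ Icc 0 T := Ioo_subset_Icc_self ht
  have hu : ContDiff ℝ ∞ (u t) := h.contDiff_velocity htI
  have hp : ContDiff ℝ ∞ (p t) := h.contDiff_pressure htI
  have hu4 : ContDiff ℝ 4 (u t) := contDiff_infty.1 hu 4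
  have hp2 : ContDiff ℝ 2 (p t) := contDiff_infty.1 hp 2
  have hQ2 : ContDiff ℝ 2 (pressurePotential (u t)) := contDiff_pressurePotential hu4 hL2
  have hη2 : ContDiff ℝ 2 fun x => p t x - pressurePotential (u t) x := hp2.sub hQ2
  have hti : t ∈ interior (Icc 0 T) := by rwa [interior_Icc]
  have hΔ : ∀ x, Δ (fun x => p t x - pressurePotential (u t) x) x = 0 := fun x => by
    have e : (fun x => p t x - pressurePotential (u t) x) = p t - pressurePotential (u t) := rfl
    rw [e, hp2.contDiffAt.laplacian_sub hQ2.contDiffAt, laplacian_pressurePotential hu4 hL2 x,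
      laplacian_pressure_eq_of_isClassicalNSSolutionOn h hti x,
      pressureSource_eq_of_isDivFree (h.divFree t htI)]
    have : VectorCalculus.divergence ((0 : ℝ → ℝ³ → ℝ³) t) x = 0 := by
      simp [VectorCalculus.divergence]
    rw [this]
    ring
  intro x _
  exact ⟨hη2.contDiffAt, Eventually.of_forall hΔ⟩

/-- The momentum equation of the unforced system solved for the pressure gradient. [folklore] -/
theorem gradient_pressure_eq (h : FluidPDE.IsClassicalNSSolutionOn (Icc 0 T) ν 0 u p) {t : ℝ}
    (ht : t ∈ Icc 0 T) (y : ℝ³) :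
    gradient (p t) y = ν • (Δ (u t)) y - FluidPDE.timeDerivWithin (Icc 0 T) u t y -
      FluidPDE.convect (u t) (u t) y := by
  have hm := h.momentum t ht y
  simp only [Pi.zero_apply, add_zero] at hm
  calc gradient (p t) y = ν • (Δ (u t)) y -
        (FluidPDE.timeDerivWithin (Icc 0 T) u t y + FluidPDE.convect (u t) (u t) y) := by
          rw [hm]; abel
    _ = _ := by abel

/-- **The probe identity** (Tao 2011, §4, proof of Lemma 4.1 (i), the computation of
`∫∫ ∇h χ_R`): at an interior time `t`, for every scale `R > 0`, centre `x₀` and direction `a`,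
the derivative of the harmonic part `h(t) = p(t) - Q[u(t)]` is
`∂ₐh(t, x₀) = ν ∫ ⟪u, Δφ a⟫ + ∫ ⟪u, (u·∇φ) a⟫ - ∫ ⟪∂ₜu, φ a⟫ - ∫ ∂ₐχ_R(z) Q[u(t)](x₀ - z) dz`
with `φ = χ_R(· - x₀)` (mean-value formula for the gradient, then the momentum equation tested
against `φ a`: the viscous term by Green's identity, the transport term by the trilinear
identity and `div u = 0`). [cite: Tao2011, §4, proof of Lemma 4.1 (i)] -/
theorem fderiv_harmonicPart_eq (h : FluidPDE.IsClassicalNSSolutionOn (Icc 0 T) ν 0 u p) {t : ℝ}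
    (ht : t ∈ Ioo 0 T) (hL2 : Integrable fun y => ‖u t y‖ ^ 2) {R : ℝ} (hR : 0 < R)
    (x₀ a : ℝ³) :
    fderiv ℝ (fun x => p t x - pressurePotential (u t) x) x₀ a =
      ν * (∫ y, ⟪u t y, (Δ (fun y => probeBump R (y - x₀))) y • a⟫)
      + (∫ y, ⟪u t y, fderiv ℝ (fun y => probeBump R (y - x₀)) y (u t y) • a⟫)
      - (∫ y, ⟪FluidPDE.timeDerivWithin (Icc 0 T) u t y, probeBump R (y - x₀) • a⟫)
      - ∫ z, fderiv ℝ (probeBump R) z a * pressurePotential (u t) (x₀ - z) := by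
  haveI : CompleteSpace ℝ³ := inferInstance
  have hT : 0 < T := ht.1.trans ht.2
  have hS : UniqueDiffOn ℝ (Icc 0 T) := uniqueDiffOn_Icc hT
  have htI : t ∈ Icc 0 T := Ioo_subset_Icc_self ht
  -- regularity of the slices
  have hu : ContDiff ℝ ∞ (u t) := h.contDiff_velocity htI
  have hp : ContDiff ℝ ∞ (p t) := h.contDiff_pressure htI
  have hu4 : ContDiff ℝ 4 (u t) := contDiff_infty.1 hu 4
  have hu2 : ContDiff ℝ 2 (u t) := contDiff_infty.1 hu 2
  have hu1 : ContDiff ℝ 1 (u t) := contDiff_infty.1 hu 1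
  have hp1 : ContDiff ℝ 1 (p t) := contDiff_infty.1 hp 1
  have huc : Continuous (u t) := hu.continuous
  set Q := pressurePotential (u t) with hQ_def
  have hQ2 : ContDiff ℝ 2 Q := contDiff_pressurePotential hu4 hL2
  have hQc : Continuous Q := hQ2.continuous
  have hη := harmonicOnNhd_pressure_sub_pressurePotential h ht hL2
  -- the bump, its translate and the vector test field
  set χ : ℝ³ → ℝ := probeBump R with hχ_def
  have hχs : ContDiff ℝ ∞ χ := contDiff_probeBump R
  have hχ1 : ContDiff ℝ 1 χ := contDiff_infty.1 hχs 1
  have hχc : HasCompactSupport χ := hasCompactSupport_probeBump hR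
  set φ : ℝ³ → ℝ := fun y => χ (y - x₀) with hφ_def
  have hφs : ContDiff ℝ ∞ φ := hχs.comp (contDiff_id.sub contDiff_const)
  have hφ2 : ContDiff ℝ 2 φ := contDiff_infty.1 hφs 2
  have hφ1 : ContDiff ℝ 1 φ := contDiff_infty.1 hφs 1
  have hφc : HasCompactSupport φ := by
    have e : φ = χ ∘ Homeomorph.addRight (-x₀) := by
      funext y; simp [hφ_def, sub_eq_add_neg]
    rw [e]
    exact hχc.comp_homeomorph _
  have hφχ : ∀ y, χ (x₀ - y) = φ y := fun y => by
    simp only [hφ_def, hχ_def]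
    rw [← probeBump_neg R (y - x₀), neg_sub]
  set Ψ : ℝ³ → ℝ³ := fun y => φ y • a with hΨ_def
  have hΨ2 : ContDiff ℝ 2 Ψ := hφ2.smul contDiff_const
  have hΨ1 : ContDiff ℝ 1 Ψ := hφ1.smul contDiff_const
  have hΨc : HasCompactSupport Ψ := hφc.smul_right (f' := fun _ => a)
  have hΨcont : Continuous Ψ := hΨ1.continuous
  -- derivatives of the test field
  have hDΨ : ∀ y w, fderiv ℝ Ψ y w = (fderiv ℝ φ y w) • a := fun y w => by
    simp only [hΨ_def]
    rw [fderiv_smul_const (hφ1.differentiable one_ne_zero y), ContinuousLinearMap.smulRight_apply]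
  have hΔΨ : ∀ y, (Δ Ψ) y = (Δ φ) y • a := fun y => by
    have e : Ψ = (ContinuousLinearMap.toSpanSingleton ℝ a) ∘ φ := by
      funext w; simp [hΨ_def, ContinuousLinearMap.toSpanSingleton_apply]
    rw [e, hφ2.contDiffAt.laplacian_CLM_comp_left]
    simp [ContinuousLinearMap.toSpanSingleton_apply]
  -- continuity of the slices entering the momentum equation
  have hΔuc : Continuous (Δ (u t)) := FluidPDE.continuous_laplacian hu2
  have hdtc : Continuous (FluidPDE.timeDerivWithin (Icc 0 T) u t) :=
    ((h.smooth_velocity.timeDerivWithin hS).contDiff_slice htI).continuous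
  have hcvc : Continuous (FluidPDE.convect (u t) (u t)) :=
    (hu1.continuous_fderiv one_ne_zero).clm_apply huc
  -- Step 1: the mean-value formula for the gradient of the harmonic part
  rw [fderiv_harmonic_eq_integral_probeBump hη hR x₀ a]
  -- Step 2: split into the pressure and the potential parts
  have hDχc : Continuous fun z => fderiv ℝ χ z a :=
    (hχ1.continuous_fderiv one_ne_zero).clm_apply continuous_const
  have hDχs : HasCompactSupport fun z => fderiv ℝ χ z a := hχc.fderiv_apply (𝕜 := ℝ) a
  have iP : Integrable fun z => fderiv ℝ χ z a * p t (x₀ - z) :=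
    (hDχc.mul (hp.continuous.comp (continuous_const.sub continuous_id))).integrable_of_hasCompactSupport
      hDχs.mul_right
  have iQ : Integrable fun z => fderiv ℝ χ z a * Q (x₀ - z) :=
    (hDχc.mul (hQc.comp (continuous_const.sub continuous_id))).integrable_of_hasCompactSupport
      hDχs.mul_right
  have e2 : ∫ z, fderiv ℝ χ z a * (p t (x₀ - z) - Q (x₀ - z)) =
      (∫ z, fderiv ℝ χ z a * p t (x₀ - z)) - ∫ z, fderiv ℝ χ z a * Q (x₀ - z) := by
    rw [← integral_sub iP iQ]
    refine integral_congr_ae (Eventually.of_forall fun z => ?_)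
    simp only [mul_sub]
  rw [e2]
  -- Step 3: the pressure part through the momentum equation
  have iL := FluidPDE.integrable_inner_of_hasCompactSupport_right hΔuc hΨcont hΨc
  have iT := FluidPDE.integrable_inner_of_hasCompactSupport_right hdtc hΨcont hΨc
  have iC := FluidPDE.integrable_inner_of_hasCompactSupport_right hcvc hΨcont hΨc
  have e3 : ∫ z, fderiv ℝ χ z a * p t (x₀ - z) = ∫ y, ⟪gradient (p t) y, Ψ y⟫ := by
    rw [integral_fderiv_mul_comp_sub hχ1 hχc hp1 x₀ a,
      ← integral_sub_left_eq_self (fun z => χ z * fderiv ℝ (p t) (x₀ - z) a) volume x₀]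
    have hg : ∀ y, ⟪gradient (p t) y, a⟫ = fderiv ℝ (p t) y a := fun y => by
      rw [← FluidPDE.inner_gradient_eq_fderiv_apply, real_inner_comm]
    refine integral_congr_ae (Eventually.of_forall fun y => ?_)
    simp only [sub_sub_cancel, hΨ_def, inner_smul_right, hg, hφχ y]
  have e4 : ∫ y, ⟪gradient (p t) y, Ψ y⟫ =
      ν * (∫ y, ⟪(Δ (u t)) y, Ψ y⟫) - (∫ y, ⟪FluidPDE.timeDerivWithin (Icc 0 T) u t y, Ψ y⟫) -
        ∫ y, ⟪FluidPDE.convect (u t) (u t) y, Ψ y⟫ := by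
    have key : ∀ y, ⟪gradient (p t) y, Ψ y⟫ = ν * ⟪(Δ (u t)) y, Ψ y⟫ -
        ⟪FluidPDE.timeDerivWithin (Icc 0 T) u t y, Ψ y⟫ - ⟪FluidPDE.convect (u t) (u t) y, Ψ y⟫ := by
      intro y
      rw [gradient_pressure_eq h htI y, inner_sub_left, inner_sub_left, inner_smul_left]
      simp
    have i2 : Integrable fun y => ν * ⟪(Δ (u t)) y, Ψ y⟫ := iL.const_mul ν
    have i1 : Integrable fun y => ν * ⟪(Δ (u t)) y, Ψ y⟫ -
        ⟪FluidPDE.timeDerivWithin (Icc 0 T) u t y, Ψ y⟫ := i2.sub iT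
    rw [integral_congr_ae (Eventually.of_forall key), integral_sub i1 iC, integral_sub i2 iT,
      integral_const_mul]
  -- Green's identity for the viscous term
  have e5 : ∫ y, ⟪(Δ (u t)) y, Ψ y⟫ = ∫ y, ⟪u t y, (Δ φ) y • a⟫ := by
    rw [FluidPDE.integral_inner_laplacian_comm hu2 hΨ2 hΨc]
    exact integral_congr_ae (Eventually.of_forall fun y => by
      show ⟪u t y, (Δ Ψ) y⟫ = ⟪u t y, (Δ φ) y • a⟫
      rw [hΔΨ y])
  -- the trilinear identity for the transport term
  have e6 : ∫ y, ⟪FluidPDE.convect (u t) (u t) y, Ψ y⟫ =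
      -∫ y, ⟪u t y, fderiv ℝ φ y (u t y) • a⟫ := by
    have h0 := FluidPDE.integral_inner_convect_add_eq_zero hu1 hu1 hΨ1 hΨc
    have hz : ∫ y, VectorCalculus.divergence (u t) y * ⟪u t y, Ψ y⟫ = 0 := by
      simp [h.divFree t htI _]
    have hc : ∫ y, ⟪u t y, FluidPDE.convect (u t) Ψ y⟫ = ∫ y, ⟪u t y, fderiv ℝ φ y (u t y) • a⟫ :=
      integral_congr_ae (Eventually.of_forall fun y => by simp only [FluidPDE.convect, hDΨ])
    linarith
  rw [e3, e4, e5, e6]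
  ring

/-! ### Bounds for the probe terms -/

/-- Properties of the translated bump `φ = χ_R(· - x₀)`: size `(m R³)⁻¹`, support in
`|y - x₀| ≤ 2R`, `‖Dφ‖ ≤ (m R⁴)⁻¹ sup‖Dθ‖`, `|Δφ| ≤ (m R⁵)⁻¹ sup|Δθ|`. [folklore] -/
theorem probeBump_translate_props {R : ℝ} (hR : 0 < R) (x₀ : ℝ³) {C₁ C₂ : ℝ}
    (hC₁ : ∀ x : ℝ³, ‖fderiv ℝ baseBump x‖ ≤ C₁)
    (hC₂ : ∀ x : ℝ³, |(Δ (baseBump : ℝ³ → ℝ)) x| ≤ C₂) :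
    (∀ y, |probeBump R (y - x₀)| ≤ (baseBumpMass ℝ³ * R ^ 3)⁻¹) ∧
    (∀ y, 2 * R < ‖y - x₀‖ → probeBump R (y - x₀) = 0) ∧
    (∀ y, ‖fderiv ℝ (fun y => probeBump R (y - x₀)) y‖ ≤ (baseBumpMass ℝ³ * R ^ 3)⁻¹ * R⁻¹ * C₁) ∧
    (∀ y, |(Δ (fun y => probeBump R (y - x₀))) y| ≤ (baseBumpMass ℝ³ * R ^ 3)⁻¹ * R⁻¹ ^ 2 * C₂) ∧
    (∀ y, 2 * R < ‖y - x₀‖ → (Δ (fun y => probeBump R (y - x₀))) y = 0) := by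
  have hd : Module.finrank ℝ ℝ³ = 3 := finrank_euclideanSpace_fin
  have e1 : (fun y : ℝ³ => probeBump R (y - x₀)) = fun y => probeBump R (y + -x₀) := by
    funext y; rw [sub_eq_add_neg]
  have e2 : (fun y : ℝ³ => probeBump R (y - x₀)) = fun y => probeBump R (-x₀ + y) := by
    funext y; rw [neg_add_eq_sub]
  refine ⟨fun y => ?_, fun y hy => probeBump_eq_zero hR hy.le, fun y => ?_, fun y => ?_, fun y hy => ?_⟩
  · have := abs_probeBump_le (E := ℝ³) hR (y - x₀); rwa [hd] at this
  · rw [e1, fderiv_comp_add_right]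
    have := norm_fderiv_probeBump_le (E := ℝ³) hR hC₁ (y + -x₀); rwa [hd] at this
  · rw [e2, laplacian_comp_const_add]
    have := abs_laplacian_probeBump_le (E := ℝ³) hR hC₂ (-x₀ + y); rwa [hd] at this
  · rw [e2, laplacian_comp_const_add]
    apply FluidPDE.laplacian_eq_zero_of_notMem_tsupport
    intro hmem
    have := tsupport_probeBump_subset hR hmem
    rw [mem_closedBall_zero_iff, neg_add_eq_sub] at this
    linarith

/-- **Weighted `L¹` bound from the energy** (Cauchy–Schwarz in AM–GM form): if `|g| ≤ c`, `g`
vanishes off `B̄(x₀, ρ)`, then for every `s > 0`,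
`∫ |g| |v| ≤ c (s vol B̄(x₀,ρ) + s⁻¹ ∫|v|²)/2`. [folklore] -/
theorem integral_abs_mul_norm_le {v : ℝ³ → ℝ³} (hvm : AEStronglyMeasurable v volume)
    (hL2 : Integrable fun y => ‖v y‖ ^ 2)
    {g : ℝ³ → ℝ} (hgm : AEStronglyMeasurable g volume) {c s ρ : ℝ} (hc : 0 ≤ c) (hs : 0 < s)
    (x₀ : ℝ³) (hg : ∀ y, |g y| ≤ c) (hg0 : ∀ y, ρ < ‖y - x₀‖ → g y = 0) :
    Integrable (fun y => |g y| * ‖v y‖) ∧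
    ∫ y, |g y| * ‖v y‖ ≤
      c * (s * (volume : Measure ℝ³).real (closedBall x₀ ρ) + s⁻¹ * ∫ y, ‖v y‖ ^ 2) / 2 := by
  set B := closedBall x₀ ρ with hB
  have hBm : MeasurableSet B := measurableSet_closedBall
  set G : ℝ³ → ℝ := fun y => B.indicator (fun _ => c * s / 2) y + c / (2 * s) * ‖v y‖ ^ 2 with hG
  have hGi : Integrable G :=
    ((integrable_indicator_iff hBm).2 (integrableOn_const measure_closedBall_lt_top.ne)).add
      (hL2.const_mul _)
  have hle : ∀ y, |g y| * ‖v y‖ ≤ G y := by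
    intro y
    by_cases hy : y ∈ B
    · have hv : ‖v y‖ ≤ (s + s⁻¹ * ‖v y‖ ^ 2) / 2 := by
        rw [le_div_iff₀ two_pos]
        have h1 : 0 ≤ (‖v y‖ - s) ^ 2 := sq_nonneg _
        have h2 : s⁻¹ * ‖v y‖ ^ 2 = ‖v y‖ ^ 2 / s := by rw [inv_mul_eq_div]
        rw [h2]
        have h3 : ‖v y‖ * 2 * s ≤ (s + ‖v y‖ ^ 2 / s) * s := by
          rw [add_mul, div_mul_cancel₀ _ hs.ne']
          nlinarith
        exact le_of_mul_le_mul_right h3 hs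
      simp only [hG, indicator_of_mem hy]
      calc |g y| * ‖v y‖ ≤ c * ((s + s⁻¹ * ‖v y‖ ^ 2) / 2) :=
            mul_le_mul (hg y) hv (norm_nonneg _) hc
        _ = c * s / 2 + c / (2 * s) * ‖v y‖ ^ 2 := by field_simp
    · have hy' : ρ < ‖y - x₀‖ := by
        rwa [hB, mem_closedBall, dist_eq_norm, not_le] at hy
      simp only [hG, indicator_of_notMem hy, hg0 y hy', abs_zero, zero_mul, zero_add]
      positivity
  have hint : Integrable fun y => |g y| * ‖v y‖ :=
    Integrable.mono' hGi ((hgm.norm).mul hvm.norm |>.congr (Eventually.of_forall fun y => by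
      simp [Real.norm_eq_abs])) (Eventually.of_forall fun y => by
        rw [Real.norm_eq_abs, abs_mul, abs_abs, abs_norm]; exact hle y)
  refine ⟨hint, ?_⟩
  calc ∫ y, |g y| * ‖v y‖ ≤ ∫ y, G y :=
        integral_mono_of_nonneg (Eventually.of_forall fun y => by positivity) hGi
          (Eventually.of_forall hle)
    _ = c * s / 2 * (volume : Measure ℝ³).real B + c / (2 * s) * ∫ y, ‖v y‖ ^ 2 := by
        simp only [hG]
        rw [integral_add ((integrable_indicator_iff hBm).2
          (integrableOn_const measure_closedBall_lt_top.ne)) (hL2.const_mul _),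
          integral_indicator hBm, setIntegral_const, integral_const_mul, smul_eq_mul, mul_comm]
    _ = c * (s * (volume : Measure ℝ³).real (closedBall x₀ ρ) + s⁻¹ * ∫ y, ‖v y‖ ^ 2) / 2 := by
        rw [hB]; field_simp

/-- Volume of the ball `B̄(x₀, 2R)` in `ℝ³`: `8R³ vol B̄(0,1)`. [folklore] -/
theorem volume_real_closedBall_two_mul (x₀ : ℝ³) {R : ℝ} (hR : 0 ≤ R) :
    (volume : Measure ℝ³).real (closedBall x₀ (2 * R)) =
      8 * R ^ 3 * (volume : Measure ℝ³).real (closedBall (0 : ℝ³) 1) := by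
  rw [Measure.addHaar_real_closedBall' volume x₀ (by positivity : 0 ≤ 2 * R),
    finrank_euclideanSpace_fin]
  ring

/-- Elementary scaling inequality for the viscous probe term. [folklore] -/
theorem probe_aux₁ {m C V E R : ℝ} (hm : 0 < m) (hC : 0 ≤ C) (hV : 0 ≤ V) (hE : 0 ≤ E)
    (hR : 1 ≤ R) :
    (m * R ^ 3)⁻¹ * R⁻¹ ^ 2 * C * (8 * R ^ 3 * V + E) ≤ m⁻¹ * C * (8 * V + 1) * (1 + E) * R⁻¹ := by
  have hR0 : 0 < R := one_pos.trans_le hR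
  have e : (m * R ^ 3)⁻¹ * R⁻¹ ^ 2 * C * (8 * R ^ 3 * V + E) =
      m⁻¹ * C * (8 * V * R⁻¹ ^ 2 + E * R⁻¹ ^ 5) := by
    field_simp
  rw [e]
  have h1 : R⁻¹ ≤ 1 := inv_le_one_of_one_le₀ hR
  have h0 : 0 < R⁻¹ := inv_pos.2 hR0
  have h2 : R⁻¹ ^ 2 ≤ R⁻¹ := by nlinarith
  have h5 : R⁻¹ ^ 5 ≤ R⁻¹ :=
    calc R⁻¹ ^ 5 ≤ R⁻¹ ^ 1 := pow_le_pow_of_le_one h0.le h1 (by norm_num)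
      _ = R⁻¹ := pow_one _
  have key : 8 * V * R⁻¹ ^ 2 + E * R⁻¹ ^ 5 ≤ (8 * V + 1) * (1 + E) * R⁻¹ := by
    have i1 := mul_le_mul_of_nonneg_left h2 (by positivity : 0 ≤ 8 * V)
    have i2 := mul_le_mul_of_nonneg_left h5 hE
    have i3 : (8 * V + E) * R⁻¹ ≤ (8 * V + 1) * (1 + E) * R⁻¹ :=
      mul_le_mul_of_nonneg_right (by nlinarith [mul_nonneg hV hE]) h0.le
    nlinarith
  calc m⁻¹ * C * (8 * V * R⁻¹ ^ 2 + E * R⁻¹ ^ 5) ≤ m⁻¹ * C * ((8 * V + 1) * (1 + E) * R⁻¹) :=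
        mul_le_mul_of_nonneg_left key (by positivity)
    _ = _ := by ring

/-- Elementary scaling inequality for the transport probe term. [folklore] -/
theorem probe_aux₂ {m C E R : ℝ} (hm : 0 < m) (hC : 0 ≤ C) (hE : 0 ≤ E) (hR : 1 ≤ R) :
    (m * R ^ 3)⁻¹ * R⁻¹ * C * E ≤ m⁻¹ * C * (1 + E) * R⁻¹ := by
  have hR0 : 0 < R := one_pos.trans_le hR
  have e : (m * R ^ 3)⁻¹ * R⁻¹ * C * E = m⁻¹ * C * (E * R⁻¹ ^ 4) := by
    field_simp
  rw [e]
  have h1 : R⁻¹ ≤ 1 := inv_le_one_of_one_le₀ hR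
  have h0 : 0 < R⁻¹ := inv_pos.2 hR0
  have h4 : R⁻¹ ^ 4 ≤ R⁻¹ :=
    calc R⁻¹ ^ 4 ≤ R⁻¹ ^ 1 := pow_le_pow_of_le_one h0.le h1 (by norm_num)
      _ = R⁻¹ := pow_one _
  have key : E * R⁻¹ ^ 4 ≤ (1 + E) * R⁻¹ := by nlinarith
  calc m⁻¹ * C * (E * R⁻¹ ^ 4) ≤ m⁻¹ * C * ((1 + E) * R⁻¹) :=
        mul_le_mul_of_nonneg_left key (by positivity)
    _ = _ := by ring

/-- Elementary scaling inequality for the boundary (time-derivative) probe term. [folklore] -/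
theorem probe_aux₃ {m V E R : ℝ} (hm : 0 < m) (hV : 0 ≤ V) (hE : 0 ≤ E) (hR : 1 ≤ R) :
    (m * R ^ 3)⁻¹ * (R⁻¹ * (8 * R ^ 3 * V) + R⁻¹⁻¹ * E) ≤ m⁻¹ * (8 * V + 1) * (1 + E) * R⁻¹ := by
  have hR0 : 0 < R := one_pos.trans_le hR
  have e : (m * R ^ 3)⁻¹ * (R⁻¹ * (8 * R ^ 3 * V) + R⁻¹⁻¹ * E) =
      m⁻¹ * (8 * V * R⁻¹ + E * R⁻¹ ^ 2) := by
    rw [inv_inv]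
    field_simp
  rw [e]
  have h1 : R⁻¹ ≤ 1 := inv_le_one_of_one_le₀ hR
  have h0 : 0 < R⁻¹ := inv_pos.2 hR0
  have h2 : R⁻¹ ^ 2 ≤ R⁻¹ := by nlinarith
  have key : 8 * V * R⁻¹ + E * R⁻¹ ^ 2 ≤ (8 * V + 1) * (1 + E) * R⁻¹ := by
    have i2 := mul_le_mul_of_nonneg_left h2 hE
    have i3 : (8 * V + E) * R⁻¹ ≤ (8 * V + 1) * (1 + E) * R⁻¹ :=
      mul_le_mul_of_nonneg_right (by nlinarith [mul_nonneg hV hE]) h0.le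
    nlinarith
  calc m⁻¹ * (8 * V * R⁻¹ + E * R⁻¹ ^ 2) ≤ m⁻¹ * ((8 * V + 1) * (1 + E) * R⁻¹) :=
        mul_le_mul_of_nonneg_left key (by positivity)
    _ = _ := by ring

/-- Elementary scaling inequality for the potential probe term. [folklore] -/
theorem probe_aux₄ {M E R : ℝ} (hM : 0 ≤ M) (hE : 0 ≤ E) (hR : 1 ≤ R) :
    M * R⁻¹ ^ 4 * E ≤ M * (1 + E) * R⁻¹ := by
  have hR0 : 0 < R := one_pos.trans_le hR
  have h1 : R⁻¹ ≤ 1 := inv_le_one_of_one_le₀ hR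
  have h0 : 0 < R⁻¹ := inv_pos.2 hR0
  have h4 : R⁻¹ ^ 4 ≤ R⁻¹ :=
    calc R⁻¹ ^ 4 ≤ R⁻¹ ^ 1 := pow_le_pow_of_le_one h0.le h1 (by norm_num)
      _ = R⁻¹ := pow_one _
  have key : R⁻¹ ^ 4 * E ≤ (1 + E) * R⁻¹ := by nlinarith
  calc M * R⁻¹ ^ 4 * E = M * (R⁻¹ ^ 4 * E) := by ring
    _ ≤ M * ((1 + E) * R⁻¹) := mul_le_mul_of_nonneg_left key hM
    _ = _ := by ring

/-- **Bound for the viscous probe term**: `|∫ ⟪v, Δφ a⟫| ≤ K (1 + E) R⁻¹` for `R ≥ 1` and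
`∫|v|² ≤ E` (Tao's `O(R^{-7/2})`, estimated crudely via `|v| ≤ (1 + |v|²)/2` on the ball). [folklore] -/
theorem exists_bound_probe_laplacian (a : ℝ³) : ∃ K, 0 ≤ K ∧ ∀ (v : ℝ³ → ℝ³) (E : ℝ),
    Continuous v → Integrable (fun y => ‖v y‖ ^ 2) → 0 ≤ E → ∫ y, ‖v y‖ ^ 2 ≤ E →
    ∀ (R : ℝ), 1 ≤ R → ∀ x₀ : ℝ³,
      |∫ y, ⟪v y, (Δ (fun y => probeBump R (y - x₀))) y • a⟫| ≤ K * (1 + E) * R⁻¹ := by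
  obtain ⟨⟨C₁, hC₁⟩, ⟨C₂, hC₂⟩⟩ := exists_bound_baseBump_derivs (E := ℝ³)
  have hC₂0 : 0 ≤ C₂ := (abs_nonneg _).trans (hC₂ 0)
  have hm0 : 0 < baseBumpMass ℝ³ := baseBumpMass_pos
  have hV₁0 : 0 ≤ (volume : Measure ℝ³).real (closedBall (0 : ℝ³) 1) := measureReal_nonneg
  refine ⟨‖a‖ * ((baseBumpMass ℝ³)⁻¹ * C₂ *
    (8 * (volume : Measure ℝ³).real (closedBall (0 : ℝ³) 1) + 1)) / 2, by positivity, ?_⟩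
  intro v E hvc hL2 hE0 hE R hR1 x₀
  have hR : 0 < R := one_pos.trans_le hR1
  obtain ⟨-, -, -, hΔ, hΔ0⟩ := probeBump_translate_props hR x₀ hC₁ hC₂
  set L := Δ (fun y => probeBump R (y - x₀)) with hL
  have hLc : Continuous L := FluidPDE.continuous_laplacian ((contDiff_probeBump (E := ℝ³) R
    (n := 2)).comp (contDiff_id.sub contDiff_const))
  obtain ⟨hIi, hI⟩ := integral_abs_mul_norm_le hvc.aestronglyMeasurable hL2 hLc.aestronglyMeasurable
    (c := (baseBumpMass ℝ³ * R ^ 3)⁻¹ * R⁻¹ ^ 2 * C₂) (s := 1) (ρ := 2 * R) (by positivity)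
    one_pos x₀ hΔ hΔ0
  rw [volume_real_closedBall_two_mul x₀ hR.le, one_mul, inv_one, one_mul] at hI
  have hpt : ∀ y, |⟪v y, L y • a⟫| ≤ ‖a‖ * (|L y| * ‖v y‖) := fun y => by
    rw [inner_smul_right, abs_mul]
    calc |L y| * |⟪v y, a⟫| ≤ |L y| * (‖v y‖ * ‖a‖) := by
          gcongr; exact abs_real_inner_le_norm _ _
      _ = ‖a‖ * (|L y| * ‖v y‖) := by ring
  calc |∫ y, ⟪v y, L y • a⟫| ≤ ∫ y, ‖a‖ * (|L y| * ‖v y‖) := by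
        rw [← Real.norm_eq_abs]
        exact norm_integral_le_of_norm_le (hIi.const_mul ‖a‖) (Eventually.of_forall fun y => by
          rw [Real.norm_eq_abs]; exact hpt y)
    _ = ‖a‖ * ∫ y, |L y| * ‖v y‖ := integral_const_mul _ _
    _ ≤ ‖a‖ * ((baseBumpMass ℝ³ * R ^ 3)⁻¹ * R⁻¹ ^ 2 * C₂ *
          (8 * R ^ 3 * (volume : Measure ℝ³).real (closedBall (0 : ℝ³) 1) + E) / 2) := by
        refine mul_le_mul_of_nonneg_left (hI.trans ?_) (norm_nonneg _)
        gcongr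
    _ ≤ ‖a‖ * ((baseBumpMass ℝ³)⁻¹ * C₂ *
          (8 * (volume : Measure ℝ³).real (closedBall (0 : ℝ³) 1) + 1) * (1 + E) * R⁻¹ / 2) := by
        gcongr ‖a‖ * (?_ / 2)
        exact probe_aux₁ hm0 hC₂0 hV₁0 hE0 hR1
    _ = _ := by ring

/-- **Bound for the transport probe term**: `|∫ ⟪v, (v·∇φ) a⟫| ≤ K (1 + E) R⁻¹` for `R ≥ 1`
(Tao's `O(R⁻⁴)` term: `‖Dφ‖ ≤ (m R⁴)⁻¹ sup‖Dθ‖`). [folklore] -/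
theorem exists_bound_probe_transport (a : ℝ³) : ∃ K, 0 ≤ K ∧ ∀ (v : ℝ³ → ℝ³) (E : ℝ),
    Continuous v → Integrable (fun y => ‖v y‖ ^ 2) → 0 ≤ E → ∫ y, ‖v y‖ ^ 2 ≤ E →
    ∀ (R : ℝ), 1 ≤ R → ∀ x₀ : ℝ³,
      |∫ y, ⟪v y, fderiv ℝ (fun y => probeBump R (y - x₀)) y (v y) • a⟫| ≤ K * (1 + E) * R⁻¹ := by
  obtain ⟨⟨C₁, hC₁⟩, ⟨C₂, hC₂⟩⟩ := exists_bound_baseBump_derivs (E := ℝ³)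
  have hC₁0 : 0 ≤ C₁ := (norm_nonneg _).trans (hC₁ 0)
  have hm0 : 0 < baseBumpMass ℝ³ := baseBumpMass_pos
  refine ⟨‖a‖ * ((baseBumpMass ℝ³)⁻¹ * C₁), by positivity, ?_⟩
  intro v E hvc hL2 hE0 hE R hR1 x₀
  have hR : 0 < R := one_pos.trans_le hR1
  obtain ⟨-, -, hD, -, -⟩ := probeBump_translate_props hR x₀ hC₁ hC₂
  set c := (baseBumpMass ℝ³ * R ^ 3)⁻¹ * R⁻¹ * C₁ with hc
  have hc0 : 0 ≤ c := by positivity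
  have hpt : ∀ y, |⟪v y, fderiv ℝ (fun y => probeBump R (y - x₀)) y (v y) • a⟫| ≤
      ‖a‖ * c * ‖v y‖ ^ 2 := fun y => by
    rw [inner_smul_right, abs_mul]
    calc |fderiv ℝ (fun y => probeBump R (y - x₀)) y (v y)| * |⟪v y, a⟫|
        ≤ (‖fderiv ℝ (fun y => probeBump R (y - x₀)) y‖ * ‖v y‖) * (‖v y‖ * ‖a‖) := by
          refine mul_le_mul ?_ (abs_real_inner_le_norm _ _) (abs_nonneg _) (by positivity)
          rw [← Real.norm_eq_abs]; exact ContinuousLinearMap.le_opNorm _ _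
      _ ≤ (c * ‖v y‖) * (‖v y‖ * ‖a‖) := by gcongr; exact hD y
      _ = ‖a‖ * c * ‖v y‖ ^ 2 := by ring
  calc |∫ y, ⟪v y, fderiv ℝ (fun y => probeBump R (y - x₀)) y (v y) • a⟫|
      ≤ ∫ y, ‖a‖ * c * ‖v y‖ ^ 2 := by
        rw [← Real.norm_eq_abs]
        exact norm_integral_le_of_norm_le (hL2.const_mul _) (Eventually.of_forall fun y => by
          rw [Real.norm_eq_abs]; exact hpt y)
    _ = ‖a‖ * (c * ∫ y, ‖v y‖ ^ 2) := by rw [integral_const_mul]; ring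
    _ ≤ ‖a‖ * (c * E) := by gcongr
    _ ≤ ‖a‖ * ((baseBumpMass ℝ³)⁻¹ * C₁ * (1 + E) * R⁻¹) := by
        gcongr ‖a‖ * ?_
        rw [hc]
        exact probe_aux₂ hm0 hC₁0 hE0 hR1
    _ = _ := by ring

/-- **Bound for the boundary probe term** `W = ∫ ⟪v, φ a⟫`: `|W| ≤ K (1 + E) R⁻¹` for `R ≥ 1`
(Tao's `O(R^{-3/2})`: `|φ| ≤ (m R³)⁻¹` on a ball of volume `8R³ vol B̄₁`, and
`|v| ≤ (R⁻¹ + R|v|²)/2`). [folklore] -/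
theorem exists_bound_probe_boundary (a : ℝ³) : ∃ K, 0 ≤ K ∧ ∀ (v : ℝ³ → ℝ³) (E : ℝ),
    Continuous v → Integrable (fun y => ‖v y‖ ^ 2) → 0 ≤ E → ∫ y, ‖v y‖ ^ 2 ≤ E →
    ∀ (R : ℝ), 1 ≤ R → ∀ x₀ : ℝ³,
      |∫ y, ⟪v y, probeBump R (y - x₀) • a⟫| ≤ K * (1 + E) * R⁻¹ := by
  obtain ⟨⟨C₁, hC₁⟩, ⟨C₂, hC₂⟩⟩ := exists_bound_baseBump_derivs (E := ℝ³)
  have hm0 : 0 < baseBumpMass ℝ³ := baseBumpMass_pos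
  have hV₁0 : 0 ≤ (volume : Measure ℝ³).real (closedBall (0 : ℝ³) 1) := measureReal_nonneg
  refine ⟨‖a‖ * ((baseBumpMass ℝ³)⁻¹ *
    (8 * (volume : Measure ℝ³).real (closedBall (0 : ℝ³) 1) + 1)) / 2, by positivity, ?_⟩
  intro v E hvc hL2 hE0 hE R hR1 x₀
  have hR : 0 < R := one_pos.trans_le hR1
  obtain ⟨hB, hB0, -, -, -⟩ := probeBump_translate_props hR x₀ hC₁ hC₂
  have hφc : Continuous fun y => probeBump R (y - x₀) :=
    (contDiff_probeBump (E := ℝ³) R (n := 0)).continuous.comp (continuous_id.sub continuous_const)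
  obtain ⟨hIi, hI⟩ := integral_abs_mul_norm_le hvc.aestronglyMeasurable hL2 hφc.aestronglyMeasurable
    (c := (baseBumpMass ℝ³ * R ^ 3)⁻¹) (s := R⁻¹) (ρ := 2 * R) (by positivity) (by positivity)
    x₀ hB hB0
  rw [volume_real_closedBall_two_mul x₀ hR.le] at hI
  have hpt : ∀ y, |⟪v y, probeBump R (y - x₀) • a⟫| ≤ ‖a‖ * (|probeBump R (y - x₀)| * ‖v y‖) :=
    fun y => by
    rw [inner_smul_right, abs_mul]
    calc |probeBump R (y - x₀)| * |⟪v y, a⟫| ≤ |probeBump R (y - x₀)| * (‖v y‖ * ‖a‖) := by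
          gcongr; exact abs_real_inner_le_norm _ _
      _ = ‖a‖ * (|probeBump R (y - x₀)| * ‖v y‖) := by ring
  calc |∫ y, ⟪v y, probeBump R (y - x₀) • a⟫| ≤ ∫ y, ‖a‖ * (|probeBump R (y - x₀)| * ‖v y‖) := by
        rw [← Real.norm_eq_abs]
        exact norm_integral_le_of_norm_le (hIi.const_mul ‖a‖) (Eventually.of_forall fun y => by
          rw [Real.norm_eq_abs]; exact hpt y)
    _ = ‖a‖ * ∫ y, |probeBump R (y - x₀)| * ‖v y‖ := integral_const_mul _ _
    _ ≤ ‖a‖ * ((baseBumpMass ℝ³ * R ^ 3)⁻¹ *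
          (R⁻¹ * (8 * R ^ 3 * (volume : Measure ℝ³).real (closedBall (0 : ℝ³) 1)) + R⁻¹⁻¹ * E) / 2) := by
        refine mul_le_mul_of_nonneg_left (hI.trans ?_) (norm_nonneg _)
        gcongr
    _ ≤ ‖a‖ * ((baseBumpMass ℝ³)⁻¹ *
          (8 * (volume : Measure ℝ³).real (closedBall (0 : ℝ³) 1) + 1) * (1 + E) * R⁻¹ / 2) := by
        gcongr ‖a‖ * (?_ / 2)
        exact probe_aux₃ hm0 hV₁0 hE0 hR1
    _ = _ := by ring

/-- **Bound for the potential probe term**: `|∫ ∂ₐχ_R(z) Q[v](x₀ - z) dz| ≤ K (1 + E) R⁻¹` for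
`R ≥ 1` (Tao's `R⁻⁴ ∫∫ uᵢuⱼ (∇Δ⁻¹∂ᵢ∂ⱼχ)(x/R)`: `∂ₐχ_R(x₀ - y) = R⁻⁴ ψ(R⁻¹(y - x₀))` with
`ψ = m⁻¹ ∂ₐθ(-·)`, then the duality bound of `PressureRepresentation`). [cite: Tao2011, §4, proof of Lemma 4.1 (i)] -/
theorem exists_bound_probe_potential (a : ℝ³) : ∃ K, 0 ≤ K ∧ ∀ (v : ℝ³ → ℝ³) (E : ℝ),
    ContDiff ℝ 2 v → Integrable (fun y => ‖v y‖ ^ 2) → 0 ≤ E → ∫ y, ‖v y‖ ^ 2 ≤ E →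
    ∀ (R : ℝ), 1 ≤ R → ∀ x₀ : ℝ³,
      |∫ z, fderiv ℝ (probeBump R) z a * pressurePotential v (x₀ - z)| ≤ K * (1 + E) * R⁻¹ := by
  set m := baseBumpMass ℝ³ with hm
  have hm0 : 0 < m := baseBumpMass_pos
  -- the fixed test function `ψ(s) = m⁻¹ ∂ₐθ(-s)`
  set ψ : ℝ³ → ℝ := fun s => m⁻¹ * fderiv ℝ baseBump (-s) a with hψ
  have hψs : ContDiff ℝ 2 ψ :=
    contDiff_const.mul ((((contDiff_baseBump (E := ℝ³) (n := 3)).fderiv_right (m := 2)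
      (by norm_num)).comp contDiff_neg).clm_apply contDiff_const)
  have hψc : HasCompactSupport ψ := by
    have h1 : HasCompactSupport fun s : ℝ³ => fderiv ℝ baseBump (-s) a :=
      ((hasCompactSupport_baseBump (E := ℝ³)).fderiv_apply (𝕜 := ℝ) a).comp_homeomorph
        (Homeomorph.neg ℝ³)
    exact h1.mul_left
  obtain ⟨M, hM⟩ := abs_integral_pressurePotential_mul_le hψs hψc
  refine ⟨max M 0, le_max_right _ _, ?_⟩
  intro v E hv hL2 hE0 hE R hR1 x₀
  have hR : 0 < R := one_pos.trans_le hR1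
  have hd : Module.finrank ℝ ℝ³ = 3 := finrank_euclideanSpace_fin
  -- rewrite the probe integral as `R⁻⁴ ∫ Q ψ_R`
  have hker : ∀ y, fderiv ℝ (probeBump R) (x₀ - y) a = R⁻¹ ^ 4 * ψ (R⁻¹ • (y - x₀)) := by
    intro y
    rw [fderiv_probeBump_apply hR, hd, hψ]
    simp only [smul_sub, neg_sub]
    rw [← hm]
    field_simp
  have e1 : ∫ z, fderiv ℝ (probeBump R) z a * pressurePotential v (x₀ - z) =
      R⁻¹ ^ 4 * ∫ y, pressurePotential v y * ψ (R⁻¹ • (y - x₀)) := by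
    rw [← integral_sub_left_eq_self
      (fun z => fderiv ℝ (probeBump R) z a * pressurePotential v (x₀ - z)) volume x₀,
      ← integral_const_mul]
    refine integral_congr_ae (Eventually.of_forall fun y => ?_)
    simp only [sub_sub_cancel, hker y]
    ring
  rw [e1, abs_mul, abs_of_pos (by positivity : (0 : ℝ) < R⁻¹ ^ 4)]
  calc R⁻¹ ^ 4 * |∫ y, pressurePotential v y * ψ (R⁻¹ • (y - x₀))|
      ≤ R⁻¹ ^ 4 * (max M 0 * ∫ y, ‖v y‖ ^ 2) := by
        refine mul_le_mul_of_nonneg_left ((hM v hv hL2 x₀ R hR).trans ?_) (by positivity)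
        exact mul_le_mul_of_nonneg_right (le_max_left _ _) (integral_nonneg fun y => by positivity)
    _ ≤ R⁻¹ ^ 4 * (max M 0 * E) := by gcongr
    _ = max M 0 * R⁻¹ ^ 4 * E := by ring
    _ ≤ max M 0 * (1 + E) * R⁻¹ := probe_aux₄ (le_max_right _ _) hE0 hR1

/-! ### The boundary term `W(t) = ∫ ⟪u(t), Ψ⟫` and the vanishing of `∇h` -/

/-- **Differentiating the boundary term in time**: for a classical solution on `[0, T]` and a
smooth compactly supported test field `Ψ`, `t ↦ ∫ ⟪u(t, y), Ψ(y)⟫ dy` has derivative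
`∫ ⟪∂ₜu(t, y), Ψ(y)⟫ dy` at every interior time (differentiation under the integral sign on a
compact `x`-support). [folklore] -/
theorem hasDerivAt_integral_inner_velocity (h : FluidPDE.IsClassicalNSSolutionOn (Icc 0 T) ν 0 u p)
    {Ψ : ℝ³ → ℝ³} (hΨ : ContDiff ℝ ∞ Ψ) (hΨc : HasCompactSupport Ψ) {t : ℝ} (ht : t ∈ Ioo 0 T) :
    HasDerivAt (fun s => ∫ y, ⟪u s y, Ψ y⟫)
      (∫ y, ⟪FluidPDE.timeDerivWithin (Icc 0 T) u t y, Ψ y⟫) t := by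
  have hΦ : FluidPDE.IsSmoothSpaceTimeOn (Ioo 0 T) fun s y => ⟪u s y, Ψ y⟫ :=
    (h.smooth_velocity.mono Ioo_subset_Icc_self).inner (FluidPDE.isSmoothSpaceTimeOn_const_time hΨ _)
  have hsupp : ∀ s ∈ Ioo 0 T, ∀ y ∉ tsupport Ψ, ⟪u s y, Ψ y⟫ = 0 := fun s _ y hy => by
    rw [image_eq_zero_of_notMem_tsupport hy, inner_zero_right]
  have hD := FluidPDE.hasDerivAt_integral_of_support_subset (μ := volume) isOpen_Ioo hΦ hΨc hsupp ht
  have heq : ∫ y, deriv (fun s => ⟪u s y, Ψ y⟫) t = ∫ y, ⟪FluidPDE.timeDerivWithin (Icc 0 T) u t y, Ψ y⟫ := by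
    refine integral_congr_ae (Eventually.of_forall fun y => ?_)
    have hl : HasDerivAt (fun s => u s y) (deriv (fun s => u s y) t) t :=
      h.smooth_velocity.mono Ioo_subset_Icc_self |>.hasDerivAt_timeLine isOpen_Ioo ht y
    have := (hl.inner ℝ (hasDerivAt_const t (Ψ y))).deriv
    simp only [inner_zero_right, zero_add] at this
    show deriv (fun s => ⟪u s y, Ψ y⟫) t = ⟪FluidPDE.timeDerivWithin (Icc 0 T) u t y, Ψ y⟫
    rw [this, FluidPDE.timeDerivWithin_eq_deriv_of_mem_nhds (Icc_mem_nhds ht.1 ht.2) u y]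
  rwa [heq] at hD

/-- The time derivative term `t ↦ ∫ ⟪∂ₜu(t, y), Ψ(y)⟫ dy` is continuous on `[0, T]` (joint
continuity of `∂ₜu` up to the boundary, compact `x`-support). [folklore] -/
theorem continuousOn_integral_inner_timeDerivWithin (hT : 0 < T)
    (h : FluidPDE.IsClassicalNSSolutionOn (Icc 0 T) ν 0 u p)
    {Ψ : ℝ³ → ℝ³} (hΨ : Continuous Ψ) (hΨc : HasCompactSupport Ψ) :
    ContinuousOn (fun t => ∫ y, ⟪FluidPDE.timeDerivWithin (Icc 0 T) u t y, Ψ y⟫) (Icc 0 T) := by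
  refine FluidPDE.continuousOn_integral_of_support_subset (μ := volume) (K := tsupport Ψ) hΨc ?_ ?_
  · have h1 := h.smooth_velocity.continuousOn_timeDerivWithin (uniqueDiffOn_Icc hT)
    have h2 : ContinuousOn (fun z : ℝ × ℝ³ => Ψ z.2) (Icc 0 T ×ˢ univ) :=
      (hΨ.comp continuous_snd).continuousOn
    exact h1.inner h2
  · intro s _ y hy
    change ⟪FluidPDE.timeDerivWithin (Icc 0 T) u s y, Ψ y⟫ = 0
    rw [image_eq_zero_of_notMem_tsupport hy, inner_zero_right]

/-- **`∇h(t) = 0` at interior times (Tao 2011, §4, proof of Lemma 4.1 (i), conclusion).** For a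
classical solution of the unforced system on `[0, T]` with `sup_t ∫|u(t)|² ≤ E₀`, the harmonic
part `h(t) = p(t) - Q[u(t)]` has vanishing derivative at every point, for every `t ∈ (0, T)`:
by the probe identity `∂ₐh(t, x₀) = -W_R'(t) + O((1 + E₀)/R)` with `|W_R| = O((1 + E₀)/R)`,
uniformly in `t`, and the real-variable uniqueness lemma of `HarmonicProbe`. [cite: Tao2011, §4, proof of Lemma 4.1 (i)] -/
theorem fderiv_harmonicPart_eq_zero (hν : 0 ≤ ν)
    (h : FluidPDE.IsClassicalNSSolutionOn (Icc 0 T) ν 0 u p) {E₀ : ℝ} (hE₀ : 0 ≤ E₀)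
    (hint : ∀ t ∈ Icc 0 T, Integrable fun y => ‖u t y‖ ^ 2)
    (hE : ∀ t ∈ Icc 0 T, ∫ y, ‖u t y‖ ^ 2 ≤ E₀) (x₀ a : ℝ³) :
    ∀ t ∈ Ioo 0 T, fderiv ℝ (fun x => p t x - pressurePotential (u t) x) x₀ a = 0 := by
  -- the constants of the four probe bounds
  obtain ⟨K₁, hK₁0, hK₁⟩ := exists_bound_probe_laplacian a
  obtain ⟨K₂, hK₂0, hK₂⟩ := exists_bound_probe_transport a
  obtain ⟨K₃, hK₃0, hK₃⟩ := exists_bound_probe_boundary a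
  obtain ⟨K₄, hK₄0, hK₄⟩ := exists_bound_probe_potential a
  obtain ⟨K, hK⟩ : ∃ K : ℝ, K = (ν * K₁ + K₂ + K₃ + K₄) * (1 + E₀) := ⟨_, rfl⟩
  have hKnn : 0 ≤ K := by rw [hK]; positivity
  have hνK : 0 ≤ ν * K₁ := mul_nonneg hν hK₁0
  have hK3le : K₃ * (1 + E₀) ≤ K := by
    rw [hK]
    exact mul_le_mul_of_nonneg_right (by linarith) (by positivity)
  have hK124le : (ν * K₁ + K₂ + K₄) * (1 + E₀) ≤ K := by
    rw [hK]
    exact mul_le_mul_of_nonneg_right (by linarith) (by positivity)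
  refine eq_zero_of_approx_antiderivative fun ε hε => ?_
  -- vacuous unless `0 < T`
  by_cases hT : 0 < T
  swap
  · exact ⟨0, 0, continuousOn_const, fun t ht => absurd (ht.1.trans ht.2) hT,
      fun t ht => absurd (ht.1.trans ht.2) hT, fun t ht => absurd (ht.1.trans ht.2) hT⟩
  -- the scale `R ≥ 1` with `K/R ≤ ε`
  obtain ⟨R, hR⟩ : ∃ R : ℝ, R = max 1 (K / ε) := ⟨_, rfl⟩
  have hR1 : 1 ≤ R := by rw [hR]; exact le_max_left _ _
  have hR0 : 0 < R := one_pos.trans_le hR1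
  have hRi : 0 ≤ R⁻¹ := inv_nonneg.2 hR0.le
  have hKR : K * R⁻¹ ≤ ε := by
    rw [← div_eq_mul_inv, div_le_iff₀ hR0]
    calc K = K / ε * ε := by field_simp
      _ ≤ R * ε := by gcongr; rw [hR]; exact le_max_right _ _
      _ = ε * R := mul_comm _ _
  -- the test field and the boundary term
  have hΨs : ContDiff ℝ ∞ fun y : ℝ³ => probeBump R (y - x₀) • a :=
    ((contDiff_probeBump (E := ℝ³) R).comp (contDiff_id.sub contDiff_const)).smul contDiff_const
  have hΨc : HasCompactSupport fun y : ℝ³ => probeBump R (y - x₀) • a := by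
    have h1 : HasCompactSupport fun y : ℝ³ => probeBump R (y - x₀) := by
      have e : (fun y : ℝ³ => probeBump R (y - x₀)) = probeBump R ∘ Homeomorph.addRight (-x₀) := by
        funext y; simp [sub_eq_add_neg]
      rw [e]
      exact (hasCompactSupport_probeBump hR0).comp_homeomorph _
    exact h1.smul_right (f' := fun _ => a)
  refine ⟨fun s => ∫ y, ⟪u s y, probeBump R (y - x₀) • a⟫,
    fun s => ∫ y, ⟪FluidPDE.timeDerivWithin (Icc 0 T) u s y, probeBump R (y - x₀) • a⟫,
    (continuousOn_integral_inner_timeDerivWithin hT h hΨs.continuous hΨc).mono Ioo_subset_Icc_self,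
    fun t ht => hasDerivAt_integral_inner_velocity h hΨs hΨc ht, fun t ht => ?_, fun t ht => ?_⟩
  · -- `|W| ≤ ε`
    have htI : t ∈ Icc 0 T := Ioo_subset_Icc_self ht
    have hb := hK₃ (u t) E₀ (h.contDiff_velocity htI).continuous (hint t htI) hE₀ (hE t htI) R hR1 x₀
    calc |∫ y, ⟪u t y, probeBump R (y - x₀) • a⟫| ≤ K₃ * (1 + E₀) * R⁻¹ := hb
      _ ≤ K * R⁻¹ := mul_le_mul_of_nonneg_right hK3le hRi
      _ ≤ ε := hKR
  · -- `|g + W'| ≤ ε`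
    have htI : t ∈ Icc 0 T := Ioo_subset_Icc_self ht
    have huc : Continuous (u t) := (h.contDiff_velocity htI).continuous
    have hu2 : ContDiff ℝ 2 (u t) := contDiff_infty.1 (h.contDiff_velocity htI) 2
    have b1 := hK₁ (u t) E₀ huc (hint t htI) hE₀ (hE t htI) R hR1 x₀
    have b2 := hK₂ (u t) E₀ huc (hint t htI) hE₀ (hE t htI) R hR1 x₀
    have b4 := hK₄ (u t) E₀ hu2 (hint t htI) hE₀ (hE t htI) R hR1 x₀
    have key := fderiv_harmonicPart_eq h ht (hint t htI) hR0 x₀ a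
    rw [key]
    dsimp only
    generalize (∫ y, ⟪u t y, (Δ (fun y => probeBump R (y - x₀))) y • a⟫) = A at b1 ⊢
    generalize (∫ y, ⟪u t y, fderiv ℝ (fun y => probeBump R (y - x₀)) y (u t y) • a⟫) = B at b2 ⊢
    generalize (∫ z, fderiv ℝ (probeBump R) z a * pressurePotential (u t) (x₀ - z)) = D at b4 ⊢
    generalize (∫ y, ⟪FluidPDE.timeDerivWithin (Icc 0 T) u t y, probeBump R (y - x₀) • a⟫) = C
    have e : ν * A + B - C - D + C = ν * A + B - D := by ring
    rw [e]
    calc |ν * A + B - D| ≤ ν * |A| + |B| + |D| := by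
          calc |ν * A + B - D| ≤ |ν * A + B| + |D| := abs_sub _ _
            _ ≤ |ν * A| + |B| + |D| := by gcongr; exact abs_add_le _ _
            _ = ν * |A| + |B| + |D| := by rw [abs_mul, abs_of_nonneg hν]
      _ ≤ ν * (K₁ * (1 + E₀) * R⁻¹) + K₂ * (1 + E₀) * R⁻¹ + K₄ * (1 + E₀) * R⁻¹ := by
          gcongr
      _ = (ν * K₁ + K₂ + K₄) * (1 + E₀) * R⁻¹ := by ring
      _ ≤ K * R⁻¹ := mul_le_mul_of_nonneg_right hK124le hRi
      _ ≤ ε := hKR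

/-- **`h(t)` is constant in space at interior times**: `p(t, x) - Q[u(t)](x) = p(t, 0) - Q[u(t)](0)`
for every `x`, `t ∈ (0, T)` (zero derivative on the connected `ℝ³`). [cite: Tao2011, §4, proof of Lemma 4.1 (i)] -/
theorem pressure_sub_pressurePotential_eq (hν : 0 ≤ ν)
    (h : FluidPDE.IsClassicalNSSolutionOn (Icc 0 T) ν 0 u p) {E₀ : ℝ} (hE₀ : 0 ≤ E₀)
    (hint : ∀ t ∈ Icc 0 T, Integrable fun y => ‖u t y‖ ^ 2)
    (hE : ∀ t ∈ Icc 0 T, ∫ y, ‖u t y‖ ^ 2 ≤ E₀) {t : ℝ} (ht : t ∈ Ioo 0 T) (x : ℝ³) :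
    p t x - pressurePotential (u t) x = p t 0 - pressurePotential (u t) 0 := by
  have htI : t ∈ Icc 0 T := Ioo_subset_Icc_self ht
  have hu4 : ContDiff ℝ 4 (u t) := contDiff_infty.1 (h.contDiff_velocity htI) 4
  have hp1 : ContDiff ℝ 1 (p t) := contDiff_infty.1 (h.contDiff_pressure htI) 1
  have hQ : ContDiff ℝ 2 (pressurePotential (u t)) := contDiff_pressurePotential hu4 (hint t htI)
  have hdiff : Differentiable ℝ fun x => p t x - pressurePotential (u t) x :=
    (hp1.differentiable one_ne_zero).sub (hQ.differentiable two_ne_zero)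
  have hzero : ∀ x, fderiv ℝ (fun x => p t x - pressurePotential (u t) x) x = 0 := fun x => by
    ext a
    rw [fderiv_harmonicPart_eq_zero hν h hE₀ hint hE x a t ht]
    rfl
  exact is_const_of_fderiv_eq_zero hdiff hzero x 0


/-! ### Joint regularity of the quadratic source; measurability of the potentials in time -/

/-- The slice divergence of a jointly smooth field is jointly smooth (on a time set of unique
differentiability). [folklore] -/
theorem IsSmoothSpaceTimeOn.divergence_slice {S : Set ℝ} {w : ℝ → ℝ³ → ℝ³}
    (hw : FluidPDE.IsSmoothSpaceTimeOn S w) (hS : UniqueDiffOn ℝ S) :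
    FluidPDE.IsSmoothSpaceTimeOn S (fun t y => VectorCalculus.divergence (w t) y) := by
  set b := stdOrthonormalBasis ℝ ℝ³
  have h1 : ∀ i, FluidPDE.IsSmoothSpaceTimeOn S (fun t y => ⟪b i, fderiv ℝ (w t) y (b i)⟫) := fun i =>
    (FluidPDE.isSmoothSpaceTimeOn_const_time contDiff_const S).inner
      ((hw.fderiv_slice hS).clm_apply (FluidPDE.isSmoothSpaceTimeOn_const_time contDiff_const S))
  have h2 : FluidPDE.IsSmoothSpaceTimeOn S (fun t y => ∑ i, ⟪b i, fderiv ℝ (w t) y (b i)⟫) :=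
    ContDiffOn.sum fun i _ => h1 i
  refine ContDiffOn.congr h2 ?_
  rintro ⟨t, y⟩ -
  exact FluidPDE.divergence_eq_sum_inner_fderiv b (w t) y

/-- The quadratic source `G[w(t)] = ∂ᵢ∂ⱼ(wᵢwⱼ)` of a jointly smooth field is jointly smooth. [folklore] -/
theorem IsSmoothSpaceTimeOn.pressureSource {S : Set ℝ} {w : ℝ → ℝ³ → ℝ³}
    (hw : FluidPDE.IsSmoothSpaceTimeOn S w) (hS : UniqueDiffOn ℝ S) :
    FluidPDE.IsSmoothSpaceTimeOn S (fun t y => pressureSource (w t) y) :=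
  ((hw.convect hw hS).add ((hw.divergence_slice hS).smul hw)).divergence_slice hS

/-- The clamp `π(t) = max 0 (min t T)` onto `[0, T]`. [folklore] -/
theorem clamp_mem {T : ℝ} (hT : 0 ≤ T) (t : ℝ) : max 0 (min t T) ∈ Icc 0 T :=
  ⟨le_max_left _ _, max_le hT (min_le_right _ _)⟩

/-- The clamp is the identity on `[0, T]`. [folklore] -/
theorem clamp_eq {T t : ℝ} (ht : t ∈ Icc 0 T) : max 0 (min t T) = t := by
  rw [min_eq_left ht.2, max_eq_right ht.1]

/-- The clamp is continuous. [folklore] -/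
theorem continuous_clamp (T : ℝ) : Continuous fun t : ℝ => max 0 (min t T) :=
  continuous_const.max (continuous_id.min continuous_const)

/-- A field jointly continuous on `[0, T] × ℝ³` becomes jointly continuous on `ℝ × ℝ³` after
clamping the time and composing the space variable with a continuous map. [folklore] -/
theorem continuous_clamp_comp {T : ℝ} (hT : 0 ≤ T) {F : ℝ × ℝ³ → ℝ} {Y : Type*}
    [TopologicalSpace Y] (hF : ContinuousOn F (Icc 0 T ×ˢ univ)) {g : Y → ℝ³} (hg : Continuous g) :
    Continuous fun q : ℝ × Y => F (max 0 (min q.1 T), g q.2) :=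
  hF.comp_continuous ((continuous_clamp T).comp continuous_fst |>.prodMk (hg.comp continuous_snd))
    fun q => mk_mem_prod (clamp_mem hT q.1) (mem_univ _)

/-- **Measurability in time of the normalising constant.** For a velocity field jointly smooth on
`[0, T] × ℝ³`, `t ↦ Q[u(π t)](0)` is measurable (`π` the clamp onto `[0, T]`): both potentials
are parametric integrals of jointly measurable integrands. [folklore] -/
theorem measurable_pressurePotential_clamp {T : ℝ} (hT : 0 < T) {u : ℝ → ℝ³ → ℝ³}
    (hu : FluidPDE.IsSmoothSpaceTimeOn (Icc 0 T) u) :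
    Measurable fun t => pressurePotential (u (max 0 (min t T))) 0 := by
  have hS := uniqueDiffOn_Icc hT
  -- joint continuity of the clamped source and velocity
  have hG : Continuous fun q : ℝ × ℝ³ => pressureSource (u (max 0 (min q.1 T))) (0 - q.2) :=
    continuous_clamp_comp hT.le (F := uncurry fun t y => pressureSource (u t) y)
      (hu.pressureSource hS).continuousOn (continuous_const.sub continuous_id)
  have hU : Continuous fun q : ℝ × ℝ³ => u (max 0 (min q.1 T)) q.2 := by
    have := hu.continuousOn.comp_continuous
      ((continuous_clamp T).comp continuous_fst |>.prodMk continuous_snd)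
      fun q => mk_mem_prod (clamp_mem hT.le q.1) (mem_univ _)
    exact this
  -- the near potential
  have h1 : Measurable fun t => nearPotential 1 2 (u (max 0 (min t T))) 0 := by
    have hF : Measurable fun q : ℝ × ℝ³ =>
        newtonNear 1 2 q.2 * pressureSource (u (max 0 (min q.1 T))) (0 - q.2) :=
      ((measurable_newtonNear 1 2).comp measurable_snd).mul hG.measurable
    exact (hF.stronglyMeasurable.integral_prod_right' (ν := volume)).measurable
  -- the far potential
  have h2 : Measurable fun t => farPotential 1 2 (u (max 0 (min t T))) 0 := by
    have hK : Continuous fun q : ℝ × ℝ³ => fderiv ℝ (fderiv ℝ (newtonFar 1 2)) (0 - q.2) :=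
      (contDiff_fderiv2_newtonFar one_pos one_lt_two).continuous.comp
        (continuous_const.sub continuous_snd)
    have hF : Measurable fun q : ℝ × ℝ³ =>
        fderiv ℝ (fderiv ℝ (newtonFar 1 2)) (0 - q.2) (u (max 0 (min q.1 T)) q.2)
          (u (max 0 (min q.1 T)) q.2) :=
      ((hK.clm_apply hU).clm_apply hU).measurable
    exact (hF.stronglyMeasurable.integral_prod_right' (ν := volume)).measurable
  exact h1.neg.sub h2

/-- **Uniform bound for the potentials along the flow**: for a velocity field jointly smooth on
`[0, T] × ℝ³` with `∫|u(t)|² ≤ E₀`, `|Q[u(t)](0)| ≤ M` for all `t ∈ [0, T]` (near part: `Γ₀ ∈ L¹`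
against the source, bounded on the compact `[0,T] × B̄₂`; far part: `‖D²Γ∞‖_∞ E₀`). [folklore] -/
theorem exists_bound_pressurePotential {T : ℝ} (hT : 0 < T) {u : ℝ → ℝ³ → ℝ³}
    (hu : FluidPDE.IsSmoothSpaceTimeOn (Icc 0 T) u) {E₀ : ℝ}
    (hint : ∀ t ∈ Icc 0 T, Integrable fun y => ‖u t y‖ ^ 2)
    (hE : ∀ t ∈ Icc 0 T, ∫ y, ‖u t y‖ ^ 2 ≤ E₀) :
    ∃ M, ∀ t ∈ Icc 0 T, |pressurePotential (u t) 0| ≤ M := by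
  have hS := uniqueDiffOn_Icc hT
  obtain ⟨MG, hMG⟩ := (hu.pressureSource hS).exists_bound isCompact_Icc
    (isCompact_closedBall (0 : ℝ³) 2)
  set MG' := max MG 0 with hMG'
  obtain ⟨m₂, -, -, hm₂, -, -⟩ := exists_bounds_fderiv2_newtonFar (r₀ := (1 : ℝ)) (r₁ := 2)
    one_pos one_lt_two
  refine ⟨MG' * (∫ z, |newtonNear (1 : ℝ) 2 z|) + m₂ * E₀, fun t ht => ?_⟩
  have hm₂0 : 0 ≤ m₂ := le_trans (norm_nonneg (fderiv ℝ (fderiv ℝ (newtonFar 1 2)) 0)) (hm₂ 0)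
  -- near part
  have h1 : |nearPotential 1 2 (u t) 0| ≤ MG' * ∫ z, |newtonNear (1 : ℝ) 2 z| := by
    rw [nearPotential, ← Real.norm_eq_abs, ← integral_const_mul]
    refine norm_integral_le_of_norm_le ((integrable_newtonNear zero_le_one one_lt_two).abs.const_mul _)
      (Eventually.of_forall fun z => ?_)
    rw [Real.norm_eq_abs, abs_mul, mul_comm (MG')]
    by_cases hz : ‖z‖ ≤ 2
    · refine mul_le_mul_of_nonneg_left ?_ (abs_nonneg _)
      have := hMG t ht (0 - z) (by rw [mem_closedBall_zero_iff, zero_sub, norm_neg]; exact hz)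
      rw [Real.norm_eq_abs] at this
      exact this.trans (le_max_left _ _)
    · rw [newtonNear_eq_zero zero_le_one one_lt_two (not_le.1 hz).le, abs_zero, zero_mul, zero_mul]
  -- far part
  have h2 : |farPotential 1 2 (u t) 0| ≤ m₂ * E₀ :=
    (abs_farPotential_le (hint t ht) hm₂ 0).trans (mul_le_mul_of_nonneg_left (hE t ht) hm₂0)
  rw [pressurePotential]
  calc |-nearPotential 1 2 (u t) 0 - farPotential 1 2 (u t) 0|
      ≤ |nearPotential 1 2 (u t) 0| + |farPotential 1 2 (u t) 0| := by
        rw [show -nearPotential 1 2 (u t) 0 - farPotential 1 2 (u t) 0 =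
          -(nearPotential 1 2 (u t) 0 + farPotential 1 2 (u t) 0) by ring, abs_neg]
        exact abs_add_le _ _
    _ ≤ _ := add_le_add h1 h2

/-! ### Assembly -/

/-- **Tao 2011, Lemma 4.1 (i), homogeneous case — discharged.** For a classical finite-energy
solution of the unforced Navier–Stokes system on `[0, T] × ℝ³`, the pressure is the normalised
pressure `-Δ⁻¹∂ᵢ∂ⱼ(uᵢuⱼ)` up to a bounded measurable function of time, for a.e. (indeed every
interior) `t`. Proof = Tao's: `p = Q[u] + h`, `h(t)` harmonic (`PressurePoisson`, `ΔQ = -∂ᵢ∂ⱼ(uᵢuⱼ)`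
from `PressureRepresentation`); testing against the rescaled bumps and the momentum equation gives
`∇h(t) = 0` (`fderiv_harmonicPart_eq_zero`); `Q[u(t)] = normalisedPressure (u t)` by the
principal-value representation; `C(t) = p(t,0) - Q[u(t)](0)` (clamped in `t`) is measurable and
bounded. The viscosity only enters through a term `ν·O(R⁻²)`, so any `ν > 0` (indeed `ν ≥ 0`) is
covered without rescaling. [cite: Tao2011, Lemma 4.1 (i)] -/
theorem tao_pressure_normalisation_holds : tao_pressure_normalisation := by
  intro ν T hν hT u p hsol hEn
  obtain ⟨Cₑ, hCₑ, hCle⟩ := hEn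
  -- the energy in real form
  have hint : ∀ t ∈ Icc 0 T, Integrable fun y => ‖u t y‖ ^ 2 := fun t ht =>
    integrable_sq_of_lintegral_enorm_sq_lt_top (hsol.contDiff_velocity ht).continuous
      ((hCle t ht).trans_lt hCₑ)
  have hE : ∀ t ∈ Icc 0 T, ∫ y, ‖u t y‖ ^ 2 ≤ Cₑ.toReal := fun t ht => by
    have h1 := hCle t ht
    rw [← ofReal_integral_norm_sq_eq_lintegral (hint t ht)] at h1
    exact (ENNReal.ofReal_le_iff_le_toReal hCₑ.ne).1 h1
  have hE0 : 0 ≤ Cₑ.toReal := ENNReal.toReal_nonneg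
  -- the normalising constant, clamped in time
  refine ⟨fun t => p (max 0 (min t T)) 0 - pressurePotential (u (max 0 (min t T))) 0, ?_, ?_, ?_⟩
  · -- measurability
    have hp : Continuous fun t => p (max 0 (min t T)) 0 := by
      have := hsol.smooth_pressure.continuousOn.comp_continuous
        ((continuous_clamp T).prodMk (continuous_const (y := (0 : ℝ³))))
        fun t => mk_mem_prod (clamp_mem hT.le t) (mem_univ _)
      exact this
    exact hp.measurable.sub (measurable_pressurePotential_clamp hT hsol.smooth_velocity)
  · -- boundedness on `[0, T]`
    obtain ⟨Mp, hMp⟩ := hsol.smooth_pressure.exists_bound isCompact_Icc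
      (isCompact_singleton (x := (0 : ℝ³)))
    obtain ⟨MQ, hMQ⟩ := exists_bound_pressurePotential hT hsol.smooth_velocity hint hE
    refine ⟨Mp + MQ, fun t ht => ?_⟩
    show |p (max 0 (min t T)) 0 - pressurePotential (u (max 0 (min t T))) 0| ≤ Mp + MQ
    rw [clamp_eq ht]
    calc |p t 0 - pressurePotential (u t) 0| ≤ |p t 0| + |pressurePotential (u t) 0| := abs_sub _ _
      _ ≤ Mp + MQ := add_le_add (by rw [← Real.norm_eq_abs]; exact hMp t ht 0 rfl) (hMQ t ht)
  · -- the identity, for a.e. (every interior) time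
    have h1 : ∀ᵐ t ∂((volume : Measure ℝ).restrict (Icc 0 T)), t ∈ Icc 0 T :=
      ae_restrict_mem measurableSet_Icc
    have h2 : ∀ᵐ t ∂(volume : Measure ℝ), t ∉ ({0} : Set ℝ) ∧ t ∉ ({T} : Set ℝ) :=
      (measure_eq_zero_iff_ae_notMem.1 (measure_singleton 0)).and
        (measure_eq_zero_iff_ae_notMem.1 (measure_singleton T))
    filter_upwards [h1, ae_restrict_of_ae h2] with t ht hne
    have htIoo : t ∈ Ioo 0 T := by
      simp only [mem_singleton_iff] at hne
      exact ⟨lt_of_le_of_ne ht.1 (Ne.symm hne.1), lt_of_le_of_ne ht.2 hne.2⟩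
    intro x
    have hu2 : ContDiff ℝ 2 (u t) := contDiff_infty.1 (hsol.contDiff_velocity ht) 2
    rw [clamp_eq ht, normalisedPressure_eq_pressurePotential hu2 (hint t ht) x]
    have := pressure_sub_pressurePotential_eq hν.le hsol hE0 hint hE htIoo x
    linarith

end DischargeR3

end Literature.Analysis.FluidPDE

end
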